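import Mathlib
import HarnessLib
import Summits.NavierStokesRegularity.NavierStokesRegularity.Theorems.HalfSpaceWindowDoorCirculationCarryingRigidityAxisTypeILiouville

/-!
# Route `HalfSpaceWindowDoor`, crux `CirculationCarryingRigidity` (stmt-NavierStokesRegularity-25311) — the ANGULAR-MEAN
# DRIFT `⟨v⟩_θ` of a door-class profile and the circle law in REMAINDER form (kinematics for the eddy-torque census theorem)

Line `eddy_torque` (LEAD ns-hsw-p1 g4).  The sourced swirl Liouville tool of this crux (`…SourcedSwirlLiouville`, KNSS 2009
Thm 5.3 with an extra radial drift) was applied by g3 (`…TiltDominatedLiouville`, `…AxisTypeILiouville`) to the axis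
circulation `F = (2π)⁻¹Γ` with the KNSS drift `u = 0`, the whole of Lei–Ren–Tian's circle term `T = ∮(v_r ω₃ − ω_r v₃) dl`
being carried by the extra radial drift — which is admissible only under the circle-averaged cone.  Here the KNSS drift is
taken to be the ANGULAR MEAN `⟨v(s)⟩_θ` of the velocity (Pineau–Vicol `angularMeanVec`, tree): it is axisymmetric, smooth,
divergence-free (`⟨div v⟩_θ = div⟨v⟩_θ`), obeys KNSS's bound `|x_h|·‖⟨v⟩_θ‖ ≤ D` under the axis-Type-I bound
`‖v(t,x)‖ ≤ D/(|x_h| + √(−t))`, and its pairing with `∇F` is EXACTLY the mean-advection part of the circle law,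
`DF[⟨v⟩_θ] = (2π)⁻¹(v̄_r Γ_r + v̄_z Γ_z) = (2π)⁻¹(v̄_r ∮ω₃ dl − v̄_z ∮ω_r dl)` (`fderiv_circF_angularMeanVec`: gradient of the
lift, `⟪⟨v⟩_θ, e_r⟫ = ⟨v_r⟩_θ = v̄_r`, `(⟨v⟩_θ)_z = v̄_z`, Stokes on circles).  What is left of the circle term is the planner's
fluctuation REMAINDER `ℛ = ∮[(v_z − v̄_z)ω_r − (v_r − v̄_r)ω₃] dl` (AxisTwistDoor `…Defs.remainder`; zero for axisymmetric
fields): `∂ₛΓ = Γ_rr − r⁻¹Γ_r + Γ_zz + ℛ − v̄_r ∮ω₃ dl + v̄_z ∮ω_r dl` (`deriv_circ_s_eq_remainder`, from AxisTwistDoor's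
`circleSwirlEquation_of_classical`).  Also: joint continuity / measurability of the drift and of `∮ω_r dl`, `v̄_r`, `v̄_z`, `ℛ`
on the open slab (for the measurable extra drift `β = −ℛ/∮ω₃` of the census theorem `…EddyTorqueLiouville`).

Seat ns-hsw-p1 g4 (LEAD of 25311, cell pub-ns-dss).  WHAT THIS IS NOT: not a statement about Navier–Stokes regularity
(Clay A): kinematics of HYPOTHETICAL blow-up profiles (KNSS ancient mild solutions); helper `--supports` 25311; nothing about
the crux or NS regularity is closed here.
-/

noncomputable section

-- the summit and its single sub-problem share the name (CONVENTIONS §1), as in every Theorems file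
set_option linter.dupNamespace false

namespace Summit.NavierStokesRegularity.NavierStokesRegularity.Theorems.HalfSpaceWindowDoorCirculationCarryingRigidityAngularMeanDrift

open MeasureTheory Set Function Filter Topology TopologicalSpace InnerProductSpace WithLp Metric
open scoped Laplacian RealInnerProductSpace ContDiff Classical
open Literature.Analysis Literature.Analysis.FluidPDE
open Summit.NavierStokesRegularity.NavierStokesRegularity.Theorems.AxisTwistDoorAveragedConeLiouvilleDefs
  (cylPt eT e3 circ vortCirc radVortCirc tiltCirc circleTerm meanR meanZ remainder SignE3)
open Summit.NavierStokesRegularity.NavierStokesRegularity.Theorems.AveragedConeLiouville.CircleStokes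
  (deriv_circ_eq_vortCirc continuous_eR inner_e3)
open Summit.NavierStokesRegularity.NavierStokesRegularity.Theorems.AveragedConeLiouville.CircleCalculus (deriv_circ_z)
open Summit.NavierStokesRegularity.NavierStokesRegularity.Theorems.AveragedConeLiouville.CircMonotone (vortCirc_zero)
open Summit.NavierStokesRegularity.NavierStokesRegularity.Theorems.AveragedConeLiouville.CircleSwirl
  (circleTerm_eq circleSwirlEquation_of_classical)
open Summit.NavierStokesRegularity.NavierStokesRegularity.Theorems.AveragedConeLiouville.ShellBookkeeping (cylRadius_cylPt)
open Summit.NavierStokesRegularity.NavierStokesRegularity.Theorems.AxisTwistDoorAveragedConeLiouvilleAxisLift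
  (lift gradient_lift contDiffAt_lift)
open Summit.NavierStokesRegularity.NavierStokesRegularity.Theorems.PoloidalWindowDoorPoloidalWindowRigidityWindow
  (isTypeIAncientMild_of_class)
open Summit.NavierStokesRegularity.NavierStokesRegularity.Theorems.HalfSpaceWindowDoorCirculationCarryingRigidityAxisCirculation
open Summit.NavierStokesRegularity.NavierStokesRegularity.Theorems.HalfSpaceWindowDoorCirculationCarryingRigidityAxisCirculationDynamics
open Summit.NavierStokesRegularity.NavierStokesRegularity.Theorems.HalfSpaceWindowDoorCirculationCarryingRigidityAxisTypeILiouville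
  (axisBound_nonneg)

-- AxisTwistDoor's angular radial unit vector `e_r(θ)` is its `…Defs.eR`; renamed on opening to avoid the clash with the radial
-- unit vector FIELD `Literature.Analysis.FluidPDE.eR`
open Summit.NavierStokesRegularity.NavierStokesRegularity.Theorems.AxisTwistDoorAveragedConeLiouvilleDefs renaming eR → eRang

variable {C D : ℝ} {v : ℝ → EuclideanSpace ℝ (Fin 3) → EuclideanSpace ℝ (Fin 3)}

/-! ### Angular means on axis circles: Pineau–Vicol `angularMean` versus the planner's `meanR`, `meanZ` -/

/-- The radial unit vector FIELD at a circle point off the axis is the angular radial unit vector: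
`e_r(cylPt r θ z) = (cos θ, sin θ, 0)` for `r > 0`. -/
theorem eR_cylPt {r : ℝ} (hr : 0 < r) (θ z : ℝ) : eR (cylPt r θ z) = eRang θ := by
  have hc := cylRadius_cylPt hr.le θ z
  rw [eR, hc]
  ext i
  fin_cases i <;> simp [cylPt, AxisTwistDoorAveragedConeLiouvilleDefs.eR] <;> field_simp

/-- The radial velocity at a circle point off the axis: `v_r(cylPt r θ z) = ⟪v, e_r(θ)⟫`. -/
theorem radialVelocity_cylPt (u : EuclideanSpace ℝ (Fin 3) → EuclideanSpace ℝ (Fin 3)) {r : ℝ} (hr : 0 < r) (θ z : ℝ) :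
    radialVelocity u (cylPt r θ z) = ⟪u (cylPt r θ z), eRang θ⟫_ℝ := by
  rw [radialVelocity, eR_cylPt hr]

/-- The circle integrands are `2π`-periodic in the angle (radial component). -/
theorem periodic_radial_integrand (u : EuclideanSpace ℝ (Fin 3) → EuclideanSpace ℝ (Fin 3)) (r z : ℝ) :
    Function.Periodic (fun θ => ⟪u (cylPt r θ z), eRang θ⟫_ℝ) (2 * Real.pi) := by
  intro θ
  have h1 : cylPt r (θ + 2 * Real.pi) z = cylPt r θ z := by
    ext i; fin_cases i <;> simp [cylPt]
  have h2 : eRang (θ + 2 * Real.pi) = eRang θ := by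
    ext i; fin_cases i <;> simp [AxisTwistDoorAveragedConeLiouvilleDefs.eR]
  simp only [h1, h2]

/-- The circle integrands are `2π`-periodic in the angle (vertical component). -/
theorem periodic_axial_integrand (u : EuclideanSpace ℝ (Fin 3) → EuclideanSpace ℝ (Fin 3)) (r z : ℝ) :
    Function.Periodic (fun θ => ⟪u (cylPt r θ z), e3⟫_ℝ) (2 * Real.pi) := by
  intro θ
  have h1 : cylPt r (θ + 2 * Real.pi) z = cylPt r θ z := by
    ext i; fin_cases i <;> simp [cylPt]
  simp only [h1]

/-- A shifted period integral of a `2π`-periodic function. -/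
theorem integral_shift_of_periodic {g : ℝ → ℝ} (hg : Function.Periodic g (2 * Real.pi)) (θ₀ : ℝ) :
    ∫ θ in (0 : ℝ)..(2 * Real.pi), g (θ + θ₀) = ∫ θ in (0 : ℝ)..(2 * Real.pi), g θ := by
  rw [intervalIntegral.integral_comp_add_right g]
  have := hg.intervalIntegral_add_eq θ₀ 0
  simp only [zero_add] at this
  rw [show 0 + θ₀ = θ₀ by ring, show 2 * Real.pi + θ₀ = θ₀ + 2 * Real.pi by ring, this]

/-- **The angular mean of the radial velocity is the planner's `meanR`** off the axis:
`⟨v_r⟩_θ(x) = (2π)⁻¹ ∮_{S(|x_h|,x₂)} ⟪v, e_r⟫ dθ`. -/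
theorem angularMean_radialVelocity (u : EuclideanSpace ℝ (Fin 3) → EuclideanSpace ℝ (Fin 3))
    {x : EuclideanSpace ℝ (Fin 3)} (hx : cylRadius x ≠ 0) (s : ℝ) (w : ℝ → EuclideanSpace ℝ (Fin 3) → EuclideanSpace ℝ (Fin 3))
    (hw : w s = u) :
    angularMean (radialVelocity u) x = meanR w (cylRadius x) (x 2) s := by
  subst hw
  have hr : 0 < cylRadius x := lt_of_le_of_ne (cylRadius_nonneg x) (Ne.symm hx)
  obtain ⟨θ₀, hy⟩ := exists_rotZ_cylPt_eq x
  rw [angularMean_apply, smul_eq_mul, meanR]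
  congr 1
  have hint : (fun θ => radialVelocity (w s) (rotZ θ x)) =
      fun θ => (fun φ => ⟪w s (cylPt (cylRadius x) φ (x 2)), eRang φ⟫_ℝ) (θ + θ₀) := by
    funext θ
    conv_lhs => rw [← hy]
    rw [← rotZ_add, rotZ_cylPt, radialVelocity_cylPt _ hr]
    simp only [zero_add]
  rw [hint, integral_shift_of_periodic (periodic_radial_integrand (w s) (cylRadius x) (x 2))]

/-- **The angular mean of the vertical velocity is the planner's `meanZ`**:
`⟨v_z⟩_θ(x) = (2π)⁻¹ ∮_{S(|x_h|,x₂)} ⟪v, e₃⟫ dθ`. -/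
theorem angularMean_axialVelocity (w : ℝ → EuclideanSpace ℝ (Fin 3) → EuclideanSpace ℝ (Fin 3)) (s : ℝ)
    (x : EuclideanSpace ℝ (Fin 3)) :
    angularMean (axialVelocity (w s)) x = meanZ w (cylRadius x) (x 2) s := by
  obtain ⟨θ₀, hy⟩ := exists_rotZ_cylPt_eq x
  rw [angularMean_apply, smul_eq_mul, meanZ]
  congr 1
  have hint : (fun θ => axialVelocity (w s) (rotZ θ x)) =
      fun θ => (fun φ => ⟪w s (cylPt (cylRadius x) φ (x 2)), e3⟫_ℝ) (θ + θ₀) := by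
    funext θ
    show axialVelocity (w s) (rotZ θ x) = ⟪w s (cylPt (cylRadius x) (θ + θ₀) (x 2)), e3⟫_ℝ
    rw [inner_e3]
    conv_lhs => rw [← hy]
    rw [← rotZ_add, rotZ_cylPt, axialVelocity, zero_add]
  rw [hint, integral_shift_of_periodic (periodic_axial_integrand (w s) (cylRadius x) (x 2))]


/-! ### The angular-mean drift `U(s,·) = ⟨v(s)⟩_θ` (Pineau–Vicol `angularMeanVec`): size, symmetry, continuity -/

/-- **The axis-Type-I bound passes to the angular mean**: `‖⟨v(s)⟩_θ(x)‖ ≤ D/(|x_h| + √(−s))` (rotations about the axis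
preserve `|x_h|` and norms). -/
theorem norm_angularMeanVec_le_axisBound
    (hDax : ∀ t < 0, ∀ x : EuclideanSpace ℝ (Fin 3), ‖v t x‖ ≤ D / (cylRadius x + Real.sqrt (-t)))
    {s : ℝ} (hs : s < 0) (x : EuclideanSpace ℝ (Fin 3)) :
    ‖angularMeanVec (v s) x‖ ≤ D / (cylRadius x + Real.sqrt (-s)) := by
  rw [angularMeanVec_apply, norm_smul, norm_inv, Real.norm_of_nonneg (by positivity)]
  have hb : ‖∫ θ in (0 : ℝ)..2 * Real.pi, rotZ (-θ) (v s (rotZ θ x))‖ ≤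
      D / (cylRadius x + Real.sqrt (-s)) * |2 * Real.pi - 0| :=
    intervalIntegral.norm_integral_le_of_norm_le_const fun θ _ => by
      rw [norm_rotZ, ← cylRadius_rotZ θ x]; exact hDax s hs _
  rw [sub_zero, abs_of_pos (by positivity)] at hb
  calc (2 * Real.pi)⁻¹ * ‖∫ θ in (0 : ℝ)..2 * Real.pi, rotZ (-θ) (v s (rotZ θ x))‖
      ≤ (2 * Real.pi)⁻¹ * (D / (cylRadius x + Real.sqrt (-s)) * (2 * Real.pi)) :=
        mul_le_mul_of_nonneg_left hb (by positivity)
    _ = D / (cylRadius x + Real.sqrt (-s)) := by field_simp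

/-- `|x_h| · ‖⟨v(s)⟩_θ(x)‖ ≤ D`: KNSS's drift bound (5.13) for the angular mean. -/
theorem cylRadius_mul_norm_angularMeanVec_le
    (hDax : ∀ t < 0, ∀ x : EuclideanSpace ℝ (Fin 3), ‖v t x‖ ≤ D / (cylRadius x + Real.sqrt (-t)))
    {s : ℝ} (hs : s < 0) (x : EuclideanSpace ℝ (Fin 3)) :
    cylRadius x * ‖angularMeanVec (v s) x‖ ≤ D := by
  have hD0 : 0 ≤ D := axisBound_nonneg hDax
  have hr := cylRadius_nonneg x
  have hsq : 0 < Real.sqrt (-s) := Real.sqrt_pos.2 (by linarith)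
  calc cylRadius x * ‖angularMeanVec (v s) x‖ ≤ cylRadius x * (D / (cylRadius x + Real.sqrt (-s))) :=
        mul_le_mul_of_nonneg_left (norm_angularMeanVec_le_axisBound hDax hs x) hr
    _ ≤ D := by
        rw [mul_div_assoc', div_le_iff₀ (by positivity)]
        nlinarith

/-- A parametric interval integral of a (vector-valued) integrand continuous on `ℝ × S` is continuous on `S`. -/
theorem continuousOn_parametric_integral_vec {P X : Type*} [TopologicalSpace P] [NormedAddCommGroup X] [NormedSpace ℝ X]
    {g : ℝ → P → X} {S : Set P}
    (hg : ContinuousOn (fun w : ℝ × P => g w.1 w.2) (univ ×ˢ S)) (a b : ℝ) :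
    ContinuousOn (fun p => ∫ θ in a..b, g θ p) S := by
  rw [continuousOn_iff_continuous_restrict]
  have hH : Continuous (uncurry fun (q : S) (θ : ℝ) => g θ q.1) := by
    have hmap : Continuous fun z : S × ℝ => ((z.2, (z.1 : P)) : ℝ × P) := by fun_prop
    have hmaps : ∀ z : S × ℝ, ((z.2, (z.1 : P)) : ℝ × P) ∈ univ ×ˢ S := fun z => ⟨mem_univ _, z.1.2⟩
    exact hg.comp_continuous hmap hmaps
  exact intervalIntegral.continuous_parametric_intervalIntegral_of_continuous' hH a b

/-- **Joint continuity of the angular-mean drift** on the open lower slab: `(s,x) ↦ ⟨v(s)⟩_θ(x)` is continuous on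
`{s < 0} × ℝ³` for a field jointly continuous there. -/
theorem continuousOn_angularMeanVec_slab (hcont : ContinuousOn (uncurry v) (Iio (0 : ℝ) ×ˢ univ)) :
    ContinuousOn (fun p : ℝ × EuclideanSpace ℝ (Fin 3) => angularMeanVec (v p.1) p.2) {p | p.1 < 0} := by
  have hrot : Continuous fun q : ℝ × EuclideanSpace ℝ (Fin 3) => rotZ q.1 q.2 := continuous_rotZ_uncurry'
  -- the integrand `(θ, (s, x)) ↦ R_{−θ} v(s)(R_θ x)` is continuous on `ℝ × slab`
  have hrot' : Continuous fun w : ℝ × (ℝ × EuclideanSpace ℝ (Fin 3)) => rotZ w.1 w.2.2 :=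
    hrot.comp₂ continuous_fst (continuous_snd.comp continuous_snd)
  have hin : Continuous fun w : ℝ × (ℝ × EuclideanSpace ℝ (Fin 3)) =>
      ((w.2.1, rotZ w.1 w.2.2) : ℝ × EuclideanSpace ℝ (Fin 3)) :=
    (continuous_fst.comp continuous_snd).prodMk hrot'
  have hmaps : MapsTo (fun w : ℝ × (ℝ × EuclideanSpace ℝ (Fin 3)) => ((w.2.1, rotZ w.1 w.2.2) : ℝ × EuclideanSpace ℝ (Fin 3)))
      (univ ×ˢ {p : ℝ × EuclideanSpace ℝ (Fin 3) | p.1 < 0}) (Iio (0 : ℝ) ×ˢ univ) :=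
    fun w hw => ⟨hw.2, mem_univ _⟩
  have hv : ContinuousOn (fun w : ℝ × (ℝ × EuclideanSpace ℝ (Fin 3)) => v w.2.1 (rotZ w.1 w.2.2))
      (univ ×ˢ {p : ℝ × EuclideanSpace ℝ (Fin 3) | p.1 < 0}) := hcont.comp hin.continuousOn hmaps
  have hg : ContinuousOn (fun w : ℝ × (ℝ × EuclideanSpace ℝ (Fin 3)) => rotZ (-w.1) (v w.2.1 (rotZ w.1 w.2.2)))
      (univ ×ˢ {p : ℝ × EuclideanSpace ℝ (Fin 3) | p.1 < 0}) := by
    have h2 : ContinuousOn (fun w : ℝ × (ℝ × EuclideanSpace ℝ (Fin 3)) =>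
        ((-w.1, v w.2.1 (rotZ w.1 w.2.2)) : ℝ × EuclideanSpace ℝ (Fin 3)))
        (univ ×ˢ {p : ℝ × EuclideanSpace ℝ (Fin 3) | p.1 < 0}) := (continuous_fst.neg).continuousOn.prodMk hv
    -- (elaborated without expected type: the higher-order unification against the goal is too expensive)
    have h3 := hrot.comp_continuousOn h2
    exact h3
  have hI := continuousOn_parametric_integral_vec
    (g := fun (θ : ℝ) (p : ℝ × EuclideanSpace ℝ (Fin 3)) => rotZ (-θ) (v p.1 (rotZ θ p.2))) hg 0 (2 * Real.pi)
  have hI' := hI.const_smul ((2 * Real.pi)⁻¹ : ℝ)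
  refine hI'.congr fun p _ => ?_
  rw [angularMeanVec_apply, Pi.smul_apply]

/-- **Joint measurability of the angular-mean drift** (extended by zero to non-negative times). -/
theorem measurable_meanDrift (hcont : ContinuousOn (uncurry v) (Iio (0 : ℝ) ×ˢ univ)) :
    Measurable (uncurry fun (s : ℝ) (x : EuclideanSpace ℝ (Fin 3)) => if s < 0 then angularMeanVec (v s) x else 0) := by
  set Slab : Set (ℝ × EuclideanSpace ℝ (Fin 3)) := {p | p.1 < 0} with hSlab
  have hSlabm : MeasurableSet Slab := measurableSet_lt measurable_fst measurable_const
  have h : Measurable (Slab.piecewise (fun p : ℝ × EuclideanSpace ℝ (Fin 3) => angularMeanVec (v p.1) p.2) (fun _ => 0)) :=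
    (continuousOn_angularMeanVec_slab hcont).measurable_piecewise continuousOn_const hSlabm
  have e : (uncurry fun (s : ℝ) (x : EuclideanSpace ℝ (Fin 3)) => if s < 0 then angularMeanVec (v s) x else 0) =
      Slab.piecewise (fun p => angularMeanVec (v p.1) p.2) (fun _ => 0) := by
    funext p
    rcases p with ⟨s, x⟩
    by_cases hs : s < 0
    · have hmem : ((s, x) : ℝ × EuclideanSpace ℝ (Fin 3)) ∈ Slab := hs
      simp only [uncurry_apply_pair, if_pos hs, Set.piecewise_eq_of_mem _ _ _ hmem]
    · have hmem : ((s, x) : ℝ × EuclideanSpace ℝ (Fin 3)) ∉ Slab := hs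
      simp only [uncurry_apply_pair, if_neg hs, Set.piecewise_eq_of_notMem _ _ _ hmem]
  rw [e]; exact h

/-- The angular-mean drift has smooth, axisymmetric, divergence-free slices (Pineau–Vicol Lemma 6.1). -/
theorem contDiff_angularMeanVec_slice (hsm : IsSmoothSpaceTimeOn (Iio (0 : ℝ)) v) {s : ℝ} (hs : s < 0) :
    ContDiff ℝ (⊤ : ℕ∞) (angularMeanVec (v s)) :=
  contDiff_angularMeanVec (hsm.contDiff_slice hs)

/-- `div ⟨v(s)⟩_θ = ⟨div v(s)⟩_θ = 0` for a divergence-free slice. -/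
theorem isDivFree_angularMeanVec (hsm : IsSmoothSpaceTimeOn (Iio (0 : ℝ)) v)
    (hdiv : ∀ t < 0, VectorCalculus.IsDivFree (v t)) {s : ℝ} (hs : s < 0) :
    VectorCalculus.IsDivFree (angularMeanVec (v s)) := by
  intro x
  have hv1 : ContDiff ℝ 1 (v s) := (hsm.contDiff_slice hs).of_le (by norm_cast)
  rw [← congrFun (angularMean_divergence hv1) x]
  have e : VectorCalculus.divergence (v s) = fun _ => (0 : ℝ) := funext fun y => hdiv s hs y
  rw [e, angularMean_apply]
  simp


/-! ### Joint continuity of the remaining circle functionals (`∮ω_r dl`, `v̄_r`, `v̄_z`, the remainder `ℛ`) -/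

/-- Joint continuity of `∮ω_r dl` in `(r,z,s)` on `s < 0`. -/
theorem continuousOn_radVortCirc (hv : IsSmoothSpaceTimeOn (Iio (0 : ℝ)) v) :
    ContinuousOn (fun q : ℝ × ℝ × ℝ => radVortCirc v q.1 q.2.1 q.2.2) {q | q.2.2 < 0} := by
  have heR : Continuous fun w : ℝ × (ℝ × ℝ × ℝ) => eRang w.1 := continuous_eR.comp continuous_fst
  have hg : ContinuousOn (fun w : ℝ × (ℝ × ℝ × ℝ) =>
      ⟪curl (v w.2.2.2) (cylPt w.2.1 w.1 w.2.2.1), eRang w.1⟫_ℝ * w.2.1) (univ ×ˢ {q | q.2.2 < 0}) :=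
    ((continuousOn_curl_cylPt hv).inner heR.continuousOn).mul (continuous_fst.comp continuous_snd).continuousOn
  exact continuousOn_parametric_integral hg 0 (2 * Real.pi)

/-- Joint continuity of the circle mean `v̄_r` in `(r,z,s)` on `s < 0`. -/
theorem continuousOn_meanR (hv : IsSmoothSpaceTimeOn (Iio (0 : ℝ)) v) :
    ContinuousOn (fun q : ℝ × ℝ × ℝ => meanR v q.1 q.2.1 q.2.2) {q | q.2.2 < 0} := by
  have heR : Continuous fun w : ℝ × (ℝ × ℝ × ℝ) => eRang w.1 := continuous_eR.comp continuous_fst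
  have hg : ContinuousOn (fun w : ℝ × (ℝ × ℝ × ℝ) =>
      ⟪v w.2.2.2 (cylPt w.2.1 w.1 w.2.2.1), eRang w.1⟫_ℝ) (univ ×ˢ {q | q.2.2 < 0}) :=
    (continuousOn_slice_cylPt hv).inner heR.continuousOn
  have h := continuousOn_parametric_integral
    (g := fun (θ : ℝ) (q : ℝ × ℝ × ℝ) => ⟪v q.2.2 (cylPt q.1 θ q.2.1), eRang θ⟫_ℝ) hg 0 (2 * Real.pi)
  exact (continuousOn_const.mul h).congr fun q _ => rfl

/-- Joint continuity of the circle mean `v̄_z` in `(r,z,s)` on `s < 0`. -/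
theorem continuousOn_meanZ (hv : IsSmoothSpaceTimeOn (Iio (0 : ℝ)) v) :
    ContinuousOn (fun q : ℝ × ℝ × ℝ => meanZ v q.1 q.2.1 q.2.2) {q | q.2.2 < 0} := by
  have hg : ContinuousOn (fun w : ℝ × (ℝ × ℝ × ℝ) =>
      ⟪v w.2.2.2 (cylPt w.2.1 w.1 w.2.2.1), e3⟫_ℝ) (univ ×ˢ {q | q.2.2 < 0}) :=
    (continuousOn_slice_cylPt hv).inner continuousOn_const
  have h := continuousOn_parametric_integral
    (g := fun (θ : ℝ) (q : ℝ × ℝ × ℝ) => ⟪v q.2.2 (cylPt q.1 θ q.2.1), e3⟫_ℝ) hg 0 (2 * Real.pi)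
  exact (continuousOn_const.mul h).congr fun q _ => rfl

/-- **The remainder in terms of LRT's circle term** at a negative time: `ℛ = v̄_r ∮ω₃ dl − v̄_z ∮ω_r dl − T`
(the tree's `circleTerm_eq`, rearranged). -/
theorem remainder_eq (hv : IsSmoothSpaceTimeOn (Iio (0 : ℝ)) v) {s : ℝ} (hs : s < 0) (r z : ℝ) :
    remainder v r z s = meanR v r z s * vortCirc v r z s - meanZ v r z s * radVortCirc v r z s - circleTerm v r z s := by
  have hv1 : ContDiff ℝ 1 (v s) := (hv.contDiff_slice hs).of_le (by norm_cast)
  have h := circleTerm_eq v hv1 r z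
  linarith

/-- Joint continuity of the fluctuation remainder `ℛ` in `(r,z,s)` on `s < 0`. -/
theorem continuousOn_remainder (hv : IsSmoothSpaceTimeOn (Iio (0 : ℝ)) v) :
    ContinuousOn (fun q : ℝ × ℝ × ℝ => remainder v q.1 q.2.1 q.2.2) {q | q.2.2 < 0} := by
  have h := (((continuousOn_meanR hv).mul (continuousOn_vortCirc hv)).sub
    ((continuousOn_meanZ hv).mul (continuousOn_radVortCirc hv))).sub (continuousOn_circleTerm hv)
  exact h.congr fun q hq => remainder_eq hv hq q.1 q.2.1

/-! ### The drift term `DF[⟨v⟩_θ]` and the circle law in remainder form -/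

/-- `⟪e_z, w⟫ = w₂`. -/
theorem inner_eZ_left (w : EuclideanSpace ℝ (Fin 3)) : ⟪eZ, w⟫_ℝ = w 2 := by
  rw [eZ, EuclideanSpace.inner_single_left]; simp

/-- **The drift term of the sourced swirl equation**: off the axis, at a negative time,
`DF(σ,·)(x)[⟨v(σ)⟩_θ(x)] = (2π)⁻¹ (v̄_r ∮ω₃ dl − v̄_z ∮ω_r dl)` (gradient of the lift `∇F = F_r e_r + F_z e_z`,
`⟪⟨v⟩_θ, e_r⟫ = v̄_r`, `(⟨v⟩_θ)_z = v̄_z`, Stokes `Γ_r = ∮ω₃ dl`, `Γ_z = −∮ω_r dl`). -/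
theorem fderiv_circF_angularMeanVec (hv : IsSmoothSpaceTimeOn (Iio (0 : ℝ)) v) {σ : ℝ} (hσ : σ < 0)
    {x : EuclideanSpace ℝ (Fin 3)} (hx : cylRadius x ≠ 0) :
    fderiv ℝ (fun y : EuclideanSpace ℝ (Fin 3) => (2 * Real.pi)⁻¹ * circ v (cylRadius y) (y 2) σ) x
        (angularMeanVec (v σ) x) =
      (2 * Real.pi)⁻¹ * (meanR v (cylRadius x) (x 2) σ * vortCirc v (cylRadius x) (x 2) σ
        - meanZ v (cylRadius x) (x 2) σ * radVortCirc v (cylRadius x) (x 2) σ) := by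
  have hΓ := contDiffOn_circ hv
  have hv1 : ContDiff ℝ 1 (v σ) := (hv.contDiff_slice hσ).of_le (by norm_cast)
  have hvc : Continuous (v σ) := hv1.continuous
  have hfun : (fun y : EuclideanSpace ℝ (Fin 3) => (2 * Real.pi)⁻¹ * circ v (cylRadius y) (y 2) σ) =
      fun y => (2 * Real.pi)⁻¹ * lift (circ v) σ y := rfl
  have hd : DifferentiableAt ℝ (lift (circ v) σ) x :=
    (contDiffAt_lift hΓ hσ hx).differentiableAt (by norm_num)
  rw [hfun, fderiv_const_mul hd, _root_.smul_apply, smul_eq_mul]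
  congr 1
  have hgrad := gradient_lift hΓ hσ hx
  have hinner : fderiv ℝ (lift (circ v) σ) x (angularMeanVec (v σ) x) =
      ⟪gradient (lift (circ v) σ) x, angularMeanVec (v σ) x⟫_ℝ := by
    rw [gradient, InnerProductSpace.toDual_symm_apply]
  rw [hinner, hgrad, inner_add_left, real_inner_smul_left, real_inner_smul_left,
    real_inner_comm (angularMeanVec (v σ) x) (eR x), inner_angularMeanVec_eR hvc, angularMean_radialVelocity (v σ) hx σ v rfl, inner_eZ_left,
    angularMeanVec_apply_two hvc, angularMean_axialVelocity v σ x, deriv_circ_eq_vortCirc v hv1, deriv_circ_z v hv1]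
  ring

/-- **The circle law in remainder form** for a door-class profile, off the axis at a negative time:
`∂ₛΓ = Γ_rr − r⁻¹Γ_r + Γ_zz + ℛ − v̄_r ∮ω₃ dl + v̄_z ∮ω_r dl` (AxisTwistDoor's `CircleSwirlEquation` for the classical
solution of the class, with Stokes `Γ_r = ∮ω₃ dl`, `Γ_z = −∮ω_r dl`). -/
theorem deriv_circ_s_eq_remainder (hrate : HasTypeITimeDecay C v)
    (hcont : ContinuousOn (uncurry v) (Iio (0 : ℝ) ×ˢ univ))
    (hmild : ∀ s t : ℝ, s < t → t < 0 → ∀ x,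
      v t x = UnboundedOperators.heatExtension (v s) (t - s) x - oseenDuhamel 1 s v v t x)
    (hdiv : ∀ t < 0, VectorCalculus.IsDivFree (v t)) {s : ℝ} (hs : s < 0) {r : ℝ} (hr : 0 < r) (z : ℝ) :
    deriv (fun s' => circ v r z s') s =
      deriv (fun r' => deriv (fun r'' => circ v r'' z s) r') r - r⁻¹ * deriv (fun r' => circ v r' z s) r
        + deriv (fun z' => deriv (fun z'' => circ v r z'' s) z') z + remainder v r z s
        - meanR v r z s * vortCirc v r z s + meanZ v r z s * radVortCirc v r z s := by
  have hA := isTypeIAncientMild_of_class hrate hcont hmild hdiv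
  obtain ⟨p, hcl⟩ := exists_isClassicalNSSolutionOn_Iio_of_isTypeIAncientMild hA
  obtain ⟨hdr, hcse⟩ := circleSwirlEquation_of_classical hcl s hs r hr z
  have hC1 : ContDiff ℝ 1 (v s) := (IsSmoothSpaceTimeOn.contDiff_slice hA.contDiffOn hs).of_le (by norm_cast)
  have hdz : deriv (fun z' => circ v r z' s) z = -radVortCirc v r z s := deriv_circ_z v hC1 r z
  rw [hdr, hdz] at hcse
  rw [hdr]
  linarith [hcse]

end Summit.NavierStokesRegularity.NavierStokesRegularity.Theorems.HalfSpaceWindowDoorCirculationCarryingRigidityAngularMeanDrift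

end
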